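import Mathlib
import Summits.MatrixMultiplication.MatrixMultiplication.Theorems.SnSubsetDichotomyPolynomialSlackAtomBasicFacts
import Summits.MatrixMultiplication.MatrixMultiplication.Theorems.SnSubsetDichotomyPolynomialSlackMarginals

/-!
# Preparatory identities for the atoms theorem (`volume_le_of_hub_atoms`)

Small combinatorial facts used by the assembly of the atoms theorem (programme B of the crux
`PolynomialSlack`, line `transport-split-hull`): the swap of the pair profile of `(U, S)` into
the `(S, U)` form expected by the entropy certificate, the row sums of a pair profile, the
level decomposition of the heavy mass at a position, and the numerical fact `20 ≤ log x` for
`x ≥ 8·10⁸`.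
-/

namespace Summit.MatrixMultiplication.MatrixMultiplication.Theorems.PolynomialSlack

open scoped BigOperators

set_option linter.dupNamespace false

/-- Swapping the two factors: the number of pairs `(u, s) ∈ U × S` with `s i = u k` equals the
number of pairs `(s, u) ∈ S × U` with `u k = s i`. -/
theorem hubAtoms_card_filter_swap {n : ℕ} (U S : Finset (Equiv.Perm (Fin n))) (k i : Fin n) :
    ((U ×ˢ S).filter fun us => us.2 i = us.1 k).card =
      ((S ×ˢ U).filter fun su => su.2 k = su.1 i).card := by
  refine Finset.card_bij (fun us _ => (us.2, us.1)) ?_ ?_ ?_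
  · intro us hus
    simp only [Finset.mem_filter, Finset.mem_product] at hus ⊢
    exact ⟨⟨hus.1.2, hus.1.1⟩, hus.2.symm⟩
  · intro a _ b _ h
    simp only [Prod.mk.injEq] at h
    exact Prod.ext h.2 h.1
  · intro su hsu
    simp only [Finset.mem_filter, Finset.mem_product] at hsu
    exact ⟨(su.2, su.1), by
      simp only [Finset.mem_filter, Finset.mem_product]
      exact ⟨⟨hsu.1.2, hsu.1.1⟩, hsu.2.symm⟩, rfl⟩

/-- The `(U, S)` pair profile read as a function of `(i, k)` is the `(S, U)` pair profile. -/
theorem hubAtoms_profile_swap {n : ℕ} (U S : Finset (Equiv.Perm (Fin n)))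
    (dC : Fin n → Fin n → ℝ)
    (hdC : ∀ k i, dC k i =
      (((U ×ˢ S).filter fun us => us.2 i = us.1 k).card : ℝ) / (U.card * S.card : ℕ)) (i k : Fin n) :
    dC k i = (((S ×ˢ U).filter fun su => su.2 k = su.1 i).card : ℝ) / (S.card * U.card : ℕ) := by
  rw [hdC, hubAtoms_card_filter_swap, Nat.mul_comm]

/-- Row sums of a pair profile: `∑_i d k i = 1` for the `(U, S)` profile at position `k`. -/
theorem hubAtoms_rowsum_eq_one {n : ℕ} (U S : Finset (Equiv.Perm (Fin n))) (hU : U.Nonempty)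
    (hS : S.Nonempty) (dC : Fin n → Fin n → ℝ)
    (hdC : ∀ k i, dC k i =
      (((U ×ˢ S).filter fun us => us.2 i = us.1 k).card : ℝ) / (U.card * S.card : ℕ)) (k : Fin n) :
    ∑ i : Fin n, dC k i = 1 := by
  simp only [hdC]
  rw [← Finset.sum_div, ← Nat.cast_sum, sum_pairMarginal_snd U S k]
  have h0 : (0 : ℝ) < (U.card * S.card : ℕ) := by exact_mod_cast Nat.mul_pos hU.card_pos hS.card_pos
  exact div_self h0.ne'

/-- The heavy mass at a position, split into dyadic levels. -/
theorem hubAtoms_sum_levels_heavy {n : ℕ} (hn : 1 ≤ n) (d : Fin n → ℝ) (θ : ℝ)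
    (hθ : 16 / (n : ℝ) ≤ θ) (hd1 : ∀ j, d j ≤ 1) :
    ∑ a : Fin (⌊Real.logb 2 ((n : ℝ) ^ 2)⌋₊ + 1),
        ∑ j ∈ Finset.univ.filter (fun j => θ ≤ d j ∧ ⌊Real.logb 2 (1 / d j)⌋₊ = a.val), d j =
      ∑ j : Fin n, (if θ ≤ d j then d j else 0) := by
  rw [sum_eq_sum_levels_of_vanish hn d θ hθ hd1 (fun j => if θ ≤ d j then d j else 0)
    (fun j hj => if_neg hj)]
  refine Finset.sum_congr rfl fun a _ => Finset.sum_congr rfl fun j hj => ?_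
  simp only [Finset.mem_filter, Finset.mem_univ, true_and] at hj
  rw [if_pos hj.1]

/-- The heavy part of a row of a pair profile has mass at most `1`. -/
theorem hubAtoms_sum_levels_le_one {n : ℕ} (hn : 1 ≤ n) (d : Fin n → ℝ) (θ : ℝ)
    (hθ : 16 / (n : ℝ) ≤ θ) (hd0 : ∀ j, 0 ≤ d j) (hd1 : ∀ j, d j ≤ 1) (hsum : ∑ j, d j = 1) :
    ∑ a : Fin (⌊Real.logb 2 ((n : ℝ) ^ 2)⌋₊ + 1),
        ∑ j ∈ Finset.univ.filter (fun j => θ ≤ d j ∧ ⌊Real.logb 2 (1 / d j)⌋₊ = a.val), d j ≤ 1 := by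
  rw [hubAtoms_sum_levels_heavy hn d θ hθ hd1, ← hsum]
  refine Finset.sum_le_sum fun j _ => ?_
  split_ifs
  · exact le_rfl
  · exact hd0 j

/-- `20 ≤ log x` once `8·10⁸ ≤ x`. -/
theorem hubAtoms_twenty_le_log {x : ℝ} (hx : 8 * 10 ^ 8 ≤ x) : 20 ≤ Real.log x := by
  have hx0 : 0 < x := by linarith
  rw [Real.le_log_iff_exp_le hx0]
  refine le_trans ?_ hx
  have h1 : Real.exp 1 < 2.7182818286 := Real.exp_one_lt_d9
  have h20 : Real.exp 20 = (Real.exp 1) ^ 20 := by rw [← Real.exp_nat_mul]; norm_num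
  rw [h20]
  have h2 : (Real.exp 1) ^ 20 ≤ (2.7182818286 : ℝ) ^ 20 :=
    pow_le_pow_left₀ (Real.exp_pos 1).le h1.le 20
  refine h2.trans ?_
  norm_num

end Summit.MatrixMultiplication.MatrixMultiplication.Theorems.PolynomialSlack
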